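import Summits.ResolutionOfSingularities.ResolutionOfSingularities.Theorems.EquisingularLiftEquisingularLiftNatTowerRoundFourDefs
import Summits.ResolutionOfSingularities.ResolutionOfSingularities.Theorems.EquisingularLiftEquisingularLiftNatTowerPointPlaneModel
import Summits.ResolutionOfSingularities.ResolutionOfSingularities.Theorems.EquisingularLiftEquisingularLiftNatModelStepChain
import Summits.ResolutionOfSingularities.ResolutionOfSingularities.Theorems.EquisingularLiftEquisingularLiftNatCentreOffGeneric
import Summits.ResolutionOfSingularities.ResolutionOfSingularities.Theorems.EquisingularLiftEquisingularLiftNatReducedExceptionalPlaneLocal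
import Summits.ResolutionOfSingularities.ResolutionOfSingularities.Theorems.EquisingularLiftEquisingularLiftNatHorizChainE1Sections
import Summits.ResolutionOfSingularities.ResolutionOfSingularities.Theorems.EquisingularLiftEquisingularLiftChainRegular
import Summits.ResolutionOfSingularities.ResolutionOfSingularities.Theorems.EquisingularLiftEquisingularLiftCentreBlowupSmooth
import Summits.ResolutionOfSingularities.ResolutionOfSingularities.Theorems.EquisingularLiftEquisingularLiftCentreBlowupFlatExceptional
import Literature.AlgebraicGeometry.Resolution.ExceptionalDivisorRegularGlobal
import Literature.AlgebraicGeometry.Resolution.BlowupsExistence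
import Summits.ResolutionOfSingularities.ResolutionOfSingularities.Theorems.EquisingularLiftCampaignW45bULTSpecialFibrePersists
import HarnessLib

/-!
# [OURS · L1 W4.5(b) · EL♮(3) · A⁵ = NEST(1), WIDTH TABLE D3, brick D3-2] THE UPSTAIRS NEST STEP — a round whose centre is a regular curve INSIDE A
# MODELLED SURFACE (the fresh exceptional plane of a point step), by (T-k) AT THAT SURFACE: `nestRound_chain_of_fact` (generic currency),
# `nestStep_chain_of_fact` (K5′ point-step currency), `Tower.exists_nestStep_stage` (B-tower stage currency = D3-1's `TowerNestB₅` clauses)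

res-L1-w45b-stub-2 g15 (desk RULING R39 2026-08-28T17:31:05Z «A⁵ := NEST(1) IS COMMISSIONED as WIDTH TABLE D3», hand D3-2 = «the upstairs NEST step case
((T-k) instance at `𝓔_q` → HSUB data after the Δ-round), incl. the exact-reduced-trace identity for the fresh plane»; downstairs step = res-L1-w45b-stub-4's
D3-1 `TowerNestB₅` (sig 0842f82aa69bf8b4): the in-carrier point step at `y` with the running surface forced to the fresh plane `E' = υ₂⁻¹{y}`, FOLLOWED BY
the Δ-round at a regular curve `Z ⊆ E'` with round‴ branch-1 side clauses and `DirStepUnobs G' E' hE' Z hZ`; customer = res-L1-w45b-lead-1's S10, whose conic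
`Γ_q ⊂ E_q` is a centre of no A⁗ move).  OURS; NOT a statement of any manuscript ([Hironaka2017] is a candidate under adjudication, nothing of it is
asserted); AI-written, weaker than expert review.  No `sorry`; standard axioms; DEF-FREE.  `--supports stmt-ResolutionOfSingularities-20148 --as helper`.

WHAT (three currencies of ONE argument).
* `nestRound_chain_of_fact` — GENERIC: at a `Ch`-stage `(X₁, σ₁, S₁)` with model square `(G', j₂, t₂)`, `j₂ '' T' = S₁`, given a MODELLED SURFACE — an
  ideal sheaf `𝓔` on `X₁` with `V(𝓔)` regular, `O`-flat, and EXACT REDUCED TRACE `𝓔·𝒪_{G'} = 𝓘⟨E'⟩` — and Δ-ROUND DATA (`Z ⊆ E' ∩ T'` closed, `T' ⊄ Z`,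
  `Z̃` regular, `Ẽ'` regular along `Z̃`, `DirStepUnobs G' E' hE' Z hZ`, a blow-up `υ₃ : G'' ⟶ G'` of `𝓘⟨Z⟩`), the named input (T-k) `EmbeddedCurveLift O k θ P q`
  gives the centre `C ⊇ 𝓔` (inside `V(𝓔)`), regular, `O`-flat, `C·𝒪_{G'} = 𝓘⟨Z⟩`, off the generic point of `Y`; its blow-up `τ₃ : X₃ ⟶ X₁`; and the new
  `Ch`-stage with model square `(j₃, t₃)` for `G''`, `j₃ ≫ τ₃ = υ₃ ≫ j₂`, the exceptional identity `(C·𝒪_{X₃})·𝒪_{G''} = 𝓘⟨Z⟩·𝒪_{G''}`, `X₃` integral /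
  locally Noetherian / regular / dominant, `G''` integral, `closure υ₃⁻¹(T' ∖ Z)` irreducible, plus the `O`-flatness of the new exceptional surface's model
  `V(C·𝒪_{X₃})` (FE-birth) — `modelStep_chain`'s output list, i.e. what the next step of either engine consumes.
* `nestStep_chain_of_fact` — K5′ CURRENCY: the modelled surface := the exceptional divisor `(ker s)·𝒪_{X₁}` of the SECTION blow-up of K5′'s point step
  (`target_elnat_of_subchainResolution'`'s point-step binders VERBATIM), its three model clauses discharged BY NAME: regular (`IsBlowup.isRegular_subscheme_comap`
  over `section_isClosedImmersion_and_isRegular_ker`), `O`-flat (`flat_exceptional_of_isBlowup_regularCentre` over `flat_kerSubschemeι_comp_of_section`), and THE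
  EXACT REDUCED TRACE OF THE FRESH PLANE `((ker s)·𝒪_{X₁})·𝒪_{F₂} = 𝓘⟨υ⁻¹{x}⟩` = K5′'s `hexc` + res-L1-w45b-lead-1's
  `comap_vanishingIdeal_singleton_eq_of_isRegularLocalRing` (only `𝒪_{F₁,x}` regular is used).
* `Tower.exists_nestStep_stage` — B-TOWER STAGE CURRENCY (= D3-1's `TowerNestB₅` clauses (1)+(2) upstairs): from the unpacked upstairs stage at `G` and the
  `(pt-reg)` hypotheses at `y`, this seat's `Tower.exists_ptReg_stage_planeModel` (…NatTowerPointPlaneModel) delivers the section step WITH the plane model;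
  then `nestRound_chain_of_fact` at that plane.  `¬ St T ⊆ Z` is DERIVED (a point of `υ₂⁻¹(T ∖ {pt})` is off the plane), so the downstairs step need not
  carry it.
WHY NOT (T-k) at `⊥` (the ν2 anchoring): for a conic `Γ ⊂ E ≅ ℙ²`, `H¹(𝒩_{Γ/G'}) ↠ H¹(𝒪_E(E)|_Γ) = H¹(ℙ¹, 𝒪(−2)) ≠ 0`; only the anchoring AT THE PLANE
is unobstructed (`𝒩_{Γ/E} = 𝒪(4)`). [folklore; pure composition]
-/

set_option linter.dupNamespace false -- mandated namespace `Summit.<Summit>.<Problem>` of this single-conjunct summit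
set_option linter.overlappingInstances false -- signatures carry `[IsDomain O] [IsDiscreteValuationRing O]`

noncomputable section

open CategoryTheory CategoryTheory.Limits AlgebraicGeometry TopologicalSpace Topology IsLocalRing
open Literature.AlgebraicGeometry.Resolution
open AlgebraicGeometry.Scheme.IdealSheafData
open Summit.ResolutionOfSingularities.ResolutionOfSingularities.Theses.EquisingularLift.Split
open Summit.ResolutionOfSingularities.ResolutionOfSingularities.Cruxes.EquisingularLift.StrataSplit

namespace Summit.ResolutionOfSingularities.ResolutionOfSingularities.Cruxes.EquisingularLiftNat.Sections

/-- **D3-2, GENERIC CURRENCY: a Δ-round inside a MODELLED surface.**  See the module docstring.  Binders: the engine context (K5′'s letters), the stage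
and its model square, the surface model `𝓔` with its three clauses, the Δ-round data downstairs, the blow-up `υ₃`; one named input (T-k).
[folklore; pure composition] [OURS · L1 W4.5b · A⁵ NEST(1) · D3-2] -/
theorem nestRound_chain_of_fact (k : Type) [Field k]
    (O : Type) [CommRing O] [IsDomain O] [IsDiscreteValuationRing O] [IsAdicComplete (IsLocalRing.maximalIdeal O) O]
    [IsAlgClosed (IsLocalRing.ResidueField O)] (θ : O →+* k) (hθ : Function.Surjective θ)
    (P : Scheme.{0}) (q : P ⟶ Spec (.of O))
    -- (T-k)
    (hFact : EmbeddedCurveLift O k θ P q)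
    (Y : Set P) (Ch : ∀ X' : Scheme.{0}, (X' ⟶ P) → Set X' → Prop)
    (hChStep : ∀ (X' X'' : Scheme.{0}) (σ' : X' ⟶ P) (S' : Set X') (C : X'.IdealSheafData) (τ : X'' ⟶ X'),
      Ch X' σ' S' → IsBlowup τ C → Scheme.IsRegular C.subscheme → Flat (C.subschemeι ≫ σ' ≫ q) →
      σ' '' (C.support : Set X') ⊆ {y | ¬ IsGenericPoint y Y} →
      (C.support : Set X') ∩ (σ' ≫ q) ⁻¹' {IsLocalRing.closedPoint O} ⊆ S' →
      Ch X'' (τ ≫ σ') (closure (τ ⁻¹' (S' \ (C.support : Set X')))))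
    (hChSplit : ∀ (X' : Scheme.{0}) (σ' : X' ⟶ P) (S' : Set X'), Ch X' σ' S' → Chain P Y X' σ' S')
    (hYsp : Y ⊆ q ⁻¹' {IsLocalRing.closedPoint O}) (hYirr : IsIrreducible Y) (hYcl : IsClosed Y)
    (hPnoeth : IsLocallyNoetherian P) (hPreg : Scheme.IsRegular P) (hqprop : IsProper q)
    -- the stage and its model
    (X₁ : Scheme.{0}) (σ₁ : X₁ ⟶ P) (S₁ : Set X₁) (hCh₁ : Ch X₁ σ₁ S₁) (hX₁int : IsIntegral X₁) (hX₁noeth : IsLocallyNoetherian X₁)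
    (hX₁reg : Scheme.IsRegular X₁) (hX₁dom : IsDominant (σ₁ ≫ q))
    (G' : Scheme.{0}) (hG' : IsIntegral G') (j₂ : G' ⟶ X₁) (t₂ : G' ⟶ Spec (.of k))
    (hsq₂ : IsPullback j₂ t₂ (σ₁ ≫ q) (Spec.map (CommRingCat.ofHom θ))) (T' : Set G') (hjT' : j₂ '' T' = S₁)
    -- the MODELLED SURFACE: `V(𝓔)` regular, `O`-flat, exact reduced trace `E'`
    (𝓔 : X₁.IdealSheafData) (hEreg : Scheme.IsRegular 𝓔.subscheme) (hEflat : Flat (𝓔.subschemeι ≫ σ₁ ≫ q))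
    (E' : Set G') (hE' : IsClosed E') (hEtrace : 𝓔.comap j₂ = vanishingIdeal (⟨E', hE'⟩ : Closeds G'))
    -- the Δ-round data downstairs and the blow-up
    (Z : Set G') (hZ : IsClosed Z) (hZE : Z ⊆ E') (hZT : Z ⊆ T') (hTZ : ¬ T' ⊆ Z)
    (hZreg : ∀ z : ↥(redSub G' Z hZ), IsRegularLocalRing ((redSub G' Z hZ).presheaf.stalk z))
    (hGreg : ∀ (i : redSub G' Z hZ ⟶ redSub G' E' hE'), i ≫ redSubι G' E' hE' = redSubι G' Z hZ →
      ∀ z : ↥(redSub G' Z hZ), IsRegularLocalRing ((redSub G' E' hE').presheaf.stalk (i z)))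
    (hunobs : DirStepUnobs G' E' hE' Z hZ)
    (G'' : Scheme.{0}) (υ₃ : G'' ⟶ G') (hυ₃ : IsBlowup υ₃ (vanishingIdeal (⟨Z, hZ⟩ : Closeds G'))) :
    ∃ (C : X₁.IdealSheafData) (X₃ : Scheme.{0}) (τ₃ : X₃ ⟶ X₁) (j₃ : G'' ⟶ X₃) (t₃ : G'' ⟶ Spec (.of k)),
      𝓔 ≤ C ∧ Scheme.IsRegular C.subscheme ∧ Flat (C.subschemeι ≫ σ₁ ≫ q) ∧
      C.comap j₂ = vanishingIdeal (⟨Z, hZ⟩ : Closeds G') ∧ (∀ c ∈ (C.support : Set X₁), ¬ IsGenericPoint (σ₁ c) Y) ∧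
      IsBlowup τ₃ C ∧ IsIntegral X₃ ∧ IsLocallyNoetherian X₃ ∧ Scheme.IsRegular X₃ ∧ IsDominant ((τ₃ ≫ σ₁) ≫ q) ∧
      IsIntegral G'' ∧ IsIrreducible (closure (υ₃ ⁻¹' (T' \ Z))) ∧
      IsPullback j₃ t₃ ((τ₃ ≫ σ₁) ≫ q) (Spec.map (CommRingCat.ofHom θ)) ∧ j₃ ≫ τ₃ = υ₃ ≫ j₂ ∧
      (C.comap τ₃).comap j₃ = (vanishingIdeal (⟨Z, hZ⟩ : Closeds G')).comap υ₃ ∧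
      Ch X₃ (τ₃ ≫ σ₁) (j₃ '' closure (υ₃ ⁻¹' (T' \ Z))) ∧
      Flat ((C.comap τ₃).subschemeι ≫ (τ₃ ≫ σ₁) ≫ q) := by
  classical
  haveI := hPnoeth; haveI := hX₁int; haveI := hX₁noeth; haveI := hG'
  -- properness of the stage over `O`
  obtain ⟨-, -, hσ₁prop⟩ := chain_isRegular P Y X₁ σ₁ S₁ (hChSplit _ _ _ hCh₁) hPnoeth hPreg
  haveI := hσ₁prop
  haveI : IsProper q := hqprop
  have hEprop : IsProper (𝓔.subschemeι ≫ σ₁ ≫ q) := inferInstance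
  -- (T-k) AT THE MODELLED SURFACE: the centre `C ⊆ V(𝓔)`
  obtain ⟨C, hEC, hCreg, hCfl, hCj, -⟩ := hFact X₁ σ₁ 𝓔 hX₁int hX₁noeth hX₁reg hEreg hEflat hEprop G' j₂ t₂ hsq₂ E' hE' hEtrace
    Z hZ hZE hZreg hGreg hunobs
  -- E1-legality of `C` upstairs: off the generic point of `Y`
  have hoff : σ₁ '' (C.support : Set X₁) ⊆ {y : P | ¬ IsGenericPoint y Y} :=
    image_support_subset_not_isGenericPoint_of_chain θ hθ q Y hYsp σ₁ S₁ (hChSplit _ _ _ hCh₁) j₂ t₂ hsq₂ T' hjT' C Z hZ hCj hTZ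
  have hCoff : ∀ c ∈ (C.support : Set X₁), ¬ IsGenericPoint (σ₁ c) Y := fun c hc => hoff ⟨c, hc, rfl⟩
  -- the blow-up of `C` and the model square for `υ₃` (`modelStep_chain`)
  have hDT : (((vanishingIdeal (⟨Z, hZ⟩ : Closeds G')) : G'.IdealSheafData).support : Set G') ⊆ T' := by
    rw [Scheme.IdealSheafData.coe_support_vanishingIdeal]; exact hZT
  have hTD : ¬ T' ⊆ (((vanishingIdeal (⟨Z, hZ⟩ : Closeds G')) : G'.IdealSheafData).support : Set G') := by
    rw [Scheme.IdealSheafData.coe_support_vanishingIdeal]; exact hTZ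
  obtain ⟨X₃, τ₃, hτ₃⟩ := exists_isBlowup X₁ C
  obtain ⟨hX₃i, hX₃n, hX₃r, hX₃dom, hG''i, hirr₃, j₃, t₃, hsq₃, hcomm₃, hCh₃⟩ :=
    modelStep_chain O k θ hθ P q Y hYirr hYcl Ch hChSplit hChStep X₁ σ₁ S₁ hCh₁ hX₁reg hX₁dom G' j₂ t₂ hsq₂ T' hjT'
      C (vanishingIdeal (⟨Z, hZ⟩ : Closeds G')) hCj hCreg hCfl hoff hDT hTD X₃ τ₃ hτ₃ G'' υ₃ hυ₃
  rw [Scheme.IdealSheafData.coe_support_vanishingIdeal] at hirr₃ hCh₃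
  have hexc₃ : (C.comap τ₃).comap j₃ = (vanishingIdeal (⟨Z, hZ⟩ : Closeds G')).comap υ₃ := by
    rw [← Scheme.IdealSheafData.comap_comp, hcomm₃, Scheme.IdealSheafData.comap_comp, hCj]
  -- FE-birth: the new exceptional surface's model `V(C·𝒪_{X₃})` is `O`-flat
  have hFE : Flat ((C.comap τ₃).subschemeι ≫ (τ₃ ≫ σ₁) ≫ q) := by
    have h := flat_exceptional_of_isBlowup_regularCentre O X₁ X₃ (σ₁ ≫ q) C hX₁reg hCreg hCfl τ₃ hτ₃
    simpa only [Category.assoc] using h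
  exact ⟨C, X₃, τ₃, j₃, t₃, hEC, hCreg, hCfl, hCj, hCoff, hτ₃, hX₃i, hX₃n, hX₃r, hX₃dom, hG''i, hirr₃, hsq₃, hcomm₃, hexc₃, hCh₃, hFE⟩

/-- **D3-2, K5′ CURRENCY: the NEST round right after K5′'s point step**, the modelled surface being the exceptional divisor `(ker s)·𝒪_{X₁}` of the
section blow-up, whose three model clauses — regular, `O`-flat, EXACT REDUCED TRACE `υ⁻¹{x}` — are discharged here by name (res-L1-w45b-lead-1's
Liu-8.1.19(b) kit: only `𝒪_{F₁,x}` regular is used).  Binders: K5′ `target_elnat_of_subchainResolution'`'s context/stage/point-step blocks VERBATIM, then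
the NEST data (`Z` inside the fresh plane and the strict transform, unobstructed IN THE PLANE) and `υ'`. [folklore; pure composition]
[OURS · L1 W4.5b · A⁵ NEST(1) · D3-2] -/
theorem nestStep_chain_of_fact (k : Type) [Field k]
    (O : Type) [CommRing O] [IsDomain O] [IsDiscreteValuationRing O] [IsAdicComplete (IsLocalRing.maximalIdeal O) O]
    [IsAlgClosed (IsLocalRing.ResidueField O)] (θ : O →+* k) (hθ : Function.Surjective θ)
    (P : Scheme.{0}) (q : P ⟶ Spec (.of O))
    (hFact : EmbeddedCurveLift O k θ P q)
    (Y : Set P) (Ch : ∀ X' : Scheme.{0}, (X' ⟶ P) → Set X' → Prop)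
    (hChStep : ∀ (X' X'' : Scheme.{0}) (σ' : X' ⟶ P) (S' : Set X') (C : X'.IdealSheafData) (τ : X'' ⟶ X'),
      Ch X' σ' S' → IsBlowup τ C → Scheme.IsRegular C.subscheme → Flat (C.subschemeι ≫ σ' ≫ q) →
      σ' '' (C.support : Set X') ⊆ {y | ¬ IsGenericPoint y Y} →
      (C.support : Set X') ∩ (σ' ≫ q) ⁻¹' {IsLocalRing.closedPoint O} ⊆ S' →
      Ch X'' (τ ≫ σ') (closure (τ ⁻¹' (S' \ (C.support : Set X')))))
    (hChSplit : ∀ (X' : Scheme.{0}) (σ' : X' ⟶ P) (S' : Set X'), Ch X' σ' S' → Chain P Y X' σ' S')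
    (hYsp : Y ⊆ q ⁻¹' {IsLocalRing.closedPoint O}) (hYirr : IsIrreducible Y) (hYcl : IsClosed Y) (_hPint : IsIntegral P)
    (hPnoeth : IsLocallyNoetherian P) (hPreg : Scheme.IsRegular P) (hqprop : IsProper q)
    -- the stage before the point step and its model
    (X' : Scheme.{0}) (σ' : X' ⟶ P) (S' : Set X') (hCh' : Ch X' σ' S') (_hX'int : IsIntegral X') (hX'noeth : IsLocallyNoetherian X')
    (hX'reg : Scheme.IsRegular X') (_hX'dom : IsDominant (σ' ≫ q))
    (F₁ : Scheme.{0}) (_hF₁ : IsIntegral F₁) (j : F₁ ⟶ X') (t : F₁ ⟶ Spec (.of k))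
    (hsq : IsPullback j t (σ' ≫ q) (Spec.map (CommRingCat.ofHom θ)))
    (T₁ : Set F₁) (_hT₁cl : IsClosed T₁) (_hT₁irr : IsIrreducible T₁) (_hjT₁ : j '' T₁ = S')
    -- the point step
    (x : F₁) (hx : IsClosed ({x} : Set F₁)) (U : X'.Opens) (_hU : Smooth (U.ι ≫ σ' ≫ q))
    (s : Spec (.of O) ⟶ X') (hs : s ≫ σ' ≫ q = 𝟙 _) (_hsU : s (IsLocalRing.closedPoint O) ∈ U) (_hsx : s (IsLocalRing.closedPoint O) = j x)
    (_hsdim : ringKrullDim (X'.presheaf.stalk (s (IsLocalRing.closedPoint O))) = ((3 + 1 : ℕ) : WithBot ℕ∞))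
    (hregx : IsRegularLocalRing (F₁.presheaf.stalk x)) (_hsoff : ∀ c ∈ (s.ker.support : Set X'), ¬ IsGenericPoint (σ' c) Y)
    (X₁ : Scheme.{0}) (τ₁ : X₁ ⟶ X') (hτ₁ : IsBlowup τ₁ s.ker) (hX₁int : IsIntegral X₁) (hX₁noeth : IsLocallyNoetherian X₁)
    (hX₁reg : Scheme.IsRegular X₁) (hX₁dom : IsDominant ((τ₁ ≫ σ') ≫ q))
    (F₂ : Scheme.{0}) (hF₂ : IsIntegral F₂) (υ : F₂ ⟶ F₁) (hυ : IsBlowup υ (vanishingIdeal (⟨{x}, hx⟩ : Closeds F₁)))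
    (j₂ : F₂ ⟶ X₁) (t₂ : F₂ ⟶ Spec (.of k)) (hsq₂ : IsPullback j₂ t₂ ((τ₁ ≫ σ') ≫ q) (Spec.map (CommRingCat.ofHom θ)))
    (_hcomm : j₂ ≫ τ₁ = υ ≫ j) (hexc : (s.ker.comap τ₁).comap j₂ = (vanishingIdeal (⟨{x}, hx⟩ : Closeds F₁)).comap υ)
    (_hirr : IsIrreducible (closure (υ ⁻¹' (T₁ \ {x})))) (hCh₁ : Ch X₁ (τ₁ ≫ σ') (j₂ '' closure (υ ⁻¹' (T₁ \ {x}))))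
    -- the NEST data: a curve inside the fresh plane `υ⁻¹{x}`, unobstructed IN THE PLANE, and its blow-up
    (Z : Set F₂) (hZ : IsClosed Z) (hZE : Z ⊆ υ ⁻¹' {x}) (hZT : Z ⊆ closure (υ ⁻¹' (T₁ \ {x})))
    (hTZ : ¬ closure (υ ⁻¹' (T₁ \ {x})) ⊆ Z)
    (hZreg : ∀ z : ↥(redSub F₂ Z hZ), IsRegularLocalRing ((redSub F₂ Z hZ).presheaf.stalk z))
    (hunobs : DirStepUnobs F₂ (υ ⁻¹' {x}) (hx.preimage υ.continuous) Z hZ)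
    (F₃ : Scheme.{0}) (υ' : F₃ ⟶ F₂) (hυ' : IsBlowup υ' (vanishingIdeal (⟨Z, hZ⟩ : Closeds F₂))) :
    ∃ (C : X₁.IdealSheafData) (X₂ : Scheme.{0}) (τ₂ : X₂ ⟶ X₁) (j₃ : F₃ ⟶ X₂) (t₃ : F₃ ⟶ Spec (.of k)),
      s.ker.comap τ₁ ≤ C ∧ Scheme.IsRegular C.subscheme ∧ Flat (C.subschemeι ≫ (τ₁ ≫ σ') ≫ q) ∧
      C.comap j₂ = vanishingIdeal (⟨Z, hZ⟩ : Closeds F₂) ∧ (∀ c ∈ (C.support : Set X₁), ¬ IsGenericPoint ((τ₁ ≫ σ') c) Y) ∧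
      IsBlowup τ₂ C ∧ IsIntegral X₂ ∧ IsLocallyNoetherian X₂ ∧ Scheme.IsRegular X₂ ∧ IsDominant ((τ₂ ≫ τ₁ ≫ σ') ≫ q) ∧
      IsIntegral F₃ ∧ IsIrreducible (closure (υ' ⁻¹' (closure (υ ⁻¹' (T₁ \ {x})) \ Z))) ∧
      IsPullback j₃ t₃ ((τ₂ ≫ τ₁ ≫ σ') ≫ q) (Spec.map (CommRingCat.ofHom θ)) ∧ j₃ ≫ τ₂ = υ' ≫ j₂ ∧
      (C.comap τ₂).comap j₃ = (vanishingIdeal (⟨Z, hZ⟩ : Closeds F₂)).comap υ' ∧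
      Ch X₂ (τ₂ ≫ τ₁ ≫ σ') (j₃ '' closure (υ' ⁻¹' (closure (υ ⁻¹' (T₁ \ {x})) \ Z))) ∧
      Flat ((C.comap τ₂).subschemeι ≫ (τ₂ ≫ τ₁ ≫ σ') ≫ q) := by
  classical
  haveI := hPnoeth; haveI := hX'noeth; haveI := hX₁int; haveI := hX₁noeth; haveI := hF₂
  -- properness / separatedness of the stage over `O`
  obtain ⟨-, -, hσ'prop⟩ := chain_isRegular P Y X' σ' S' (hChSplit _ _ _ hCh') hPnoeth hPreg
  haveI := hσ'prop
  haveI : IsProper q := hqprop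
  -- `F₁` is locally Noetherian (a closed subscheme of `X'`)
  haveI : IsClosedImmersion (Spec.map (CommRingCat.ofHom θ)) := IsClosedImmersion.spec_of_surjective _ hθ
  haveI : IsClosedImmersion j := MorphismProperty.IsStableUnderBaseChange.of_isPullback hsq.flip inferInstance
  haveI hF₁noeth : IsLocallyNoetherian F₁ := LocallyOfFiniteType.isLocallyNoetherian j
  -- the section centre: regular and `O`-flat; THE PLANE MODEL `(ker s)·𝒪_{X₁}`: regular, `O`-flat, exact reduced trace `υ⁻¹{x}`
  obtain ⟨-, hsreg, -, -⟩ := section_isClosedImmersion_and_isRegular_ker O X' (σ' ≫ q) s hs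
  have hsflat : Flat (s.ker.subschemeι ≫ σ' ≫ q) := flat_kerSubschemeι_comp_of_section O (σ' ≫ q) s hs
  have hEreg : Scheme.IsRegular (s.ker.comap τ₁).subscheme := hτ₁.isRegular_subscheme_comap hX'reg hsreg
  have hEflat : Flat ((s.ker.comap τ₁).subschemeι ≫ (τ₁ ≫ σ') ≫ q) := by
    have h := flat_exceptional_of_isBlowup_regularCentre O X' X₁ (σ' ≫ q) s.ker hX'reg hsreg hsflat τ₁ hτ₁
    simpa only [Category.assoc] using h
  have hEtrace : (s.ker.comap τ₁).comap j₂ = vanishingIdeal (⟨υ ⁻¹' {x}, hx.preimage υ.continuous⟩ : Closeds F₂) :=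
    hexc.trans (comap_vanishingIdeal_singleton_eq_of_isRegularLocalRing hx hregx hυ)
  have hplane : Scheme.IsRegular (redSub F₂ (υ ⁻¹' {x}) (hx.preimage υ.continuous)) :=
    isRegular_subscheme_vanishingIdeal_preimage_singleton_of_isRegularLocalRing hx hregx hυ
  exact nestRound_chain_of_fact k O θ hθ P q hFact Y Ch hChStep hChSplit hYsp hYirr hYcl hPnoeth hPreg hqprop
    X₁ (τ₁ ≫ σ') (j₂ '' closure (υ ⁻¹' (T₁ \ {x}))) hCh₁ hX₁int hX₁noeth hX₁reg hX₁dom F₂ hF₂ j₂ t₂ hsq₂ _ rfl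
    (s.ker.comap τ₁) hEreg hEflat (υ ⁻¹' {x}) (hx.preimage υ.continuous) hEtrace Z hZ hZE hZT hTZ hZreg (fun i _ z => hplane (i z)) hunobs F₃ υ' hυ'


/-- **D3-2, B-TOWER STAGE CURRENCY = `TowerNestB₅`'s clauses (1)+(2) upstairs (`Tower.exists_nestStep_stage`).**  From the unpacked upstairs `Ch`-stage at
`G` (model square `jG`, `jG '' T = S`), the `(pt-reg)` hypotheses at the closed point `pt ∈ T` (`T ⊄ {pt}`, `𝒪_{G,pt}` regular, `υ₂ = Bl_pt`) and the
Δ-round data inside the fresh plane `E' = υ₂⁻¹{pt}` (D3-1's clause (2): `Z ⊆ St T`, `Z ⊆ E'`, `Z̃` regular, `Ẽ'` regular along `Z̃`, `DirStepUnobs G' E' hE' Z hZ`,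
`υ₃ = Bl_Z`; `Z.Nonempty` / `IsIrreducible Z` / «ambient regular along `Z̃`» are NOT needed upstairs and `St T ⊄ Z` is DERIVED), the named input (T-k) gives:
this seat's `Tower.exists_ptReg_stage_planeModel` output VERBATIM (section `s`, `τ = Bl_{ker s}`, model square `j₂` for `G'`, the plane model
`(ker s)·𝒪_{X''}` with (e-i)–(e-iv), FE, Cartier) AND the Δ-round block of `nestRound_chain_of_fact` at that plane (centre `C ⊇ (ker s)·𝒪_{X''}`, its
blow-up `τ₃`, model square `j₃` for `G''`, exceptional identity, `Ch`-stage, FE-birth of the new exceptional surface).  For res-L1-w45b-stub-4's D3-3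
(`TowerNestB₅` case of the HSUB re-assembly). [folklore; pure composition] [OURS · L1 W4.5b · A⁵ NEST(1) · D3-2] -/
theorem Tower.exists_nestStep_stage (O : Type) [CommRing O] [IsDomain O] [IsDiscreteValuationRing O] [IsAdicComplete (maximalIdeal O) O]
    [IsAlgClosed (ResidueField O)] (k : Type) [Field k] (θ : O →+* k) (hθ : Function.Surjective θ)
    (P : Scheme.{0}) (q : P ⟶ Spec (.of O)) (Y : Set P) (hYsp : Y ⊆ q ⁻¹' {closedPoint O}) (hYirr : IsIrreducible Y)
    (hYcl : IsClosed Y) [IsProper q] (hPnoeth : IsLocallyNoetherian P) (hPreg : Scheme.IsRegular P)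
    (Ch : ∀ X' : Scheme.{0}, (X' ⟶ P) → Set X' → Prop)
    (hChain : ∀ (X' : Scheme.{0}) (σ : X' ⟶ P) (S : Set X'), Ch X' σ S → Chain P Y X' σ S)
    (hStep : ∀ (X' X'' : Scheme.{0}) (σ' : X' ⟶ P) (S' : Set X') (C : X'.IdealSheafData) (τ : X'' ⟶ X'),
      Ch X' σ' S' → IsBlowup τ C → Scheme.IsRegular C.subscheme → Flat (C.subschemeι ≫ σ' ≫ q) →
      σ' '' (C.support : Set X') ⊆ {x : P | ¬ IsGenericPoint x Y} →
      (C.support : Set X') ∩ (σ' ≫ q) ⁻¹' {closedPoint O} ⊆ S' →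
      Ch X'' (τ ≫ σ') (closure (τ ⁻¹' (S' \ (C.support : Set X')))))
    -- (T-k)
    (hFact : EmbeddedCurveLift O k θ P q)
    -- the upstairs stage at `G`
    (X : Scheme.{0}) (σ : X ⟶ P) (S : Set X) (hCh : Ch X σ S) [IsIntegral X] [IsLocallyNoetherian X] (hXreg : Scheme.IsRegular X)
    (hdom : IsDominant (σ ≫ q)) (G : Scheme.{0}) [IsIntegral G] (jG : G ⟶ X) (tG : G ⟶ Spec (.of k))
    (hsq : IsPullback jG tG (σ ≫ q) (Spec.map (CommRingCat.ofHom θ))) (T : Set G) (hTS : jG '' T = S)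
    -- (1) the in-carrier point step at `pt`
    (pt : G) (hyc : IsClosed ({pt} : Set G)) (hyT : pt ∈ T) (hTy : ¬ T ⊆ {pt}) (hGreg : IsRegularLocalRing (G.presheaf.stalk pt))
    (G' : Scheme.{0}) (υ₂ : G' ⟶ G) (hυ₂ : IsBlowup υ₂ (vanishingIdeal ⟨{pt}, hyc⟩))
    -- (2) the Δ-round inside the fresh plane
    (E' : Set G') (hE' : IsClosed E') (hEdef : E' = υ₂ ⁻¹' {pt})
    (Z : Set G') (hZ : IsClosed Z) (hZT : Z ⊆ closure (υ₂ ⁻¹' (T \ {pt}))) (hZE : Z ⊆ E')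
    (hZreg : ∀ z : ↥(redSub G' Z hZ), IsRegularLocalRing ((redSub G' Z hZ).presheaf.stalk z))
    (hE'reg : ∀ (i : redSub G' Z hZ ⟶ redSub G' E' hE'), i ≫ redSubι G' E' hE' = redSubι G' Z hZ →
      ∀ z : ↥(redSub G' Z hZ), IsRegularLocalRing ((redSub G' E' hE').presheaf.stalk (i z)))
    (hunobs : DirStepUnobs G' E' hE' Z hZ)
    (G'' : Scheme.{0}) (υ₃ : G'' ⟶ G') (hυ₃ : IsBlowup υ₃ (vanishingIdeal (⟨Z, hZ⟩ : Closeds G'))) :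
    ∃ (s : Spec (.of O) ⟶ X) (X'' : Scheme.{0}) (τ : X'' ⟶ X) (j₂ : G' ⟶ X'') (t₂ : G' ⟶ Spec (.of k))
      (C : X''.IdealSheafData) (X₃ : Scheme.{0}) (τ₃ : X₃ ⟶ X'') (j₃ : G'' ⟶ X₃) (t₃ : G'' ⟶ Spec (.of k)),
      -- the section step (as `Tower.exists_ptReg_stage_planeModel`)
      (s ≫ σ ≫ q = 𝟙 _ ∧ s (closedPoint O) = jG pt ∧ IsBlowup τ s.ker ∧
      Scheme.IsRegular s.ker.subscheme ∧ Flat (s.ker.subschemeι ≫ σ ≫ q) ∧ s.ker.comap jG = vanishingIdeal ⟨{pt}, hyc⟩ ∧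
      (∀ c ∈ (s.ker.support : Set X), ¬ IsGenericPoint (σ c) Y) ∧
      (s.ker.support : Set X) ∩ (σ ≫ q) ⁻¹' {closedPoint O} = {jG pt} ∧
      (∀ I : X.IdealSheafData, jG pt ∉ (I.support : Set X) → Disjoint (I.support : Set X) (s.ker.support : Set X)) ∧
      Ch X'' (τ ≫ σ) (j₂ '' closure (υ₂ ⁻¹' (T \ {pt}))) ∧ Scheme.IsRegular X'' ∧ IsLocallyNoetherian X'' ∧ IsIntegral X'' ∧
      IsDominant ((τ ≫ σ) ≫ q) ∧ IsIntegral G' ∧ IsIrreducible (closure (υ₂ ⁻¹' (T \ {pt}))) ∧ IsLocallyNoetherian G ∧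
      IsPullback j₂ t₂ ((τ ≫ σ) ≫ q) (Spec.map (CommRingCat.ofHom θ)) ∧ j₂ ≫ τ = υ₂ ≫ jG ∧
      (s.ker.comap τ).comap j₂ = (vanishingIdeal ⟨{pt}, hyc⟩ : G.IdealSheafData).comap υ₂ ∧
      j₂ '' closure (υ₂ ⁻¹' (T \ {pt})) = closure (τ ⁻¹' (S \ (s.ker.support : Set X))) ∧
      (∀ hE : IsClosed (υ₂ ⁻¹' ({pt} : Set G)), (s.ker.comap τ).comap j₂ = vanishingIdeal (⟨υ₂ ⁻¹' {pt}, hE⟩ : Closeds G')) ∧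
      (∀ z : X'', (stalkIdeal (s.ker.comap τ) z).IsPrincipal) ∧ Scheme.IsRegular (s.ker.comap τ).subscheme ∧
      (τ ≫ σ) '' ((s.ker.comap τ).support : Set X'') ⊆ {p : P | ¬ IsGenericPoint p Y} ∧
      Flat ((s.ker.comap τ).subschemeι ≫ (τ ≫ σ) ≫ q) ∧ IsEffectiveCartier (s.ker.comap τ)) ∧
      -- the Δ-round inside the plane (as `nestRound_chain_of_fact`)
      (s.ker.comap τ ≤ C ∧ Scheme.IsRegular C.subscheme ∧ Flat (C.subschemeι ≫ (τ ≫ σ) ≫ q) ∧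
      C.comap j₂ = vanishingIdeal (⟨Z, hZ⟩ : Closeds G') ∧ (∀ c ∈ (C.support : Set X''), ¬ IsGenericPoint ((τ ≫ σ) c) Y) ∧
      IsBlowup τ₃ C ∧ IsIntegral X₃ ∧ IsLocallyNoetherian X₃ ∧ Scheme.IsRegular X₃ ∧ IsDominant ((τ₃ ≫ τ ≫ σ) ≫ q) ∧
      IsIntegral G'' ∧ IsIrreducible (closure (υ₃ ⁻¹' (closure (υ₂ ⁻¹' (T \ {pt})) \ Z))) ∧
      IsPullback j₃ t₃ ((τ₃ ≫ τ ≫ σ) ≫ q) (Spec.map (CommRingCat.ofHom θ)) ∧ j₃ ≫ τ₃ = υ₃ ≫ j₂ ∧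
      (C.comap τ₃).comap j₃ = (vanishingIdeal (⟨Z, hZ⟩ : Closeds G')).comap υ₃ ∧
      Ch X₃ (τ₃ ≫ τ ≫ σ) (j₃ '' closure (υ₃ ⁻¹' (closure (υ₂ ⁻¹' (T \ {pt})) \ Z))) ∧
      Flat ((C.comap τ₃).subschemeι ≫ (τ₃ ≫ τ ≫ σ) ≫ q)) := by
  classical
  subst hEdef
  -- the section step WITH the plane model (…NatTowerPointPlaneModel)
  obtain ⟨s, X'', τ, j₂, t₂, hs, hss₀, hτ, hsreg, hsflat, hCD, hsoff, hCb, hdisj, hCh'', hreg'', hnoeth'', hint'', hdom'', hG'int, hT'irr, hGnoeth,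
      hsq₂, hcomm, hcarrier, hsets, hEi, hEii, hEiii, hEiv, hEfe, hEcart⟩ :=
    Tower.exists_ptReg_stage_planeModel O k θ hθ P q Y hYsp hYirr hYcl hPnoeth hPreg Ch hChain hStep X σ S hCh hXreg hdom G jG tG hsq T hTS
      pt hyc hyT hTy hGreg G' υ₂ hυ₂
  haveI := hGnoeth
  haveI := hG'int
  -- `St T ⊄ Z`: a point of `υ₂⁻¹(T ∖ {pt})` lies off the plane
  have hne : (vanishingIdeal ⟨{pt}, hyc⟩ : G.IdealSheafData) ≠ ⊥ := fun h => by
    have hsupp : ((vanishingIdeal ⟨{pt}, hyc⟩ : G.IdealSheafData).support : Set G) = {pt} :=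
      Scheme.IdealSheafData.coe_support_vanishingIdeal _
    rw [h, Scheme.IdealSheafData.support_bot] at hsupp
    exact hTy (fun t _ => hsupp ▸ trivial)
  have hsurj : Function.Surjective υ₂ :=
    Summit.ResolutionOfSingularities.ResolutionOfSingularities.Theorems.EquisingularLift.surjective_of_isBlowup hυ₂ hne
  have hTZ : ¬ closure (υ₂ ⁻¹' (T \ {pt})) ⊆ Z := by
    intro h
    obtain ⟨t, htT, htpt⟩ := Set.not_subset.mp hTy
    obtain ⟨w, hw⟩ := hsurj t
    have hw' : w ∈ closure (υ₂ ⁻¹' (T \ {pt})) := by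
      refine subset_closure ?_
      show υ₂ w ∈ T \ {pt}
      rw [hw]; exact ⟨htT, htpt⟩
    have hwE : υ₂ w ∈ ({pt} : Set G) := hZE (h hw')
    rw [hw] at hwE
    exact htpt hwE
  -- the Δ-round at the plane `(ker s)·𝒪_{X''}`
  obtain ⟨C, X₃, τ₃, j₃, t₃, hround⟩ :=
    nestRound_chain_of_fact k O θ hθ P q hFact Y Ch hStep hChain hYsp hYirr hYcl hPnoeth hPreg inferInstance
      X'' (τ ≫ σ) (j₂ '' closure (υ₂ ⁻¹' (T \ {pt}))) hCh'' hint'' hnoeth'' hreg'' hdom'' G' hG'int j₂ t₂ hsq₂ _ rfl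
      (s.ker.comap τ) hEiii hEfe (υ₂ ⁻¹' {pt}) hE' (hEi hE') Z hZ hZE hZT hTZ hZreg hE'reg hunobs G'' υ₃ hυ₃
  exact ⟨s, X'', τ, j₂, t₂, C, X₃, τ₃, j₃, t₃, ⟨hs, hss₀, hτ, hsreg, hsflat, hCD, hsoff, hCb, hdisj, hCh'', hreg'', hnoeth'', hint'', hdom'', hG'int,
    hT'irr, hGnoeth, hsq₂, hcomm, hcarrier, hsets, hEi, hEii, hEiii, hEiv, hEfe, hEcart⟩, hround⟩

end Summit.ResolutionOfSingularities.ResolutionOfSingularities.Cruxes.EquisingularLiftNat.Sections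

end
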